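import Summits.FinalStateConjecture.FinalStateConjecture.Theorems.EIHFluxBalanceInertialRecessionStubSlavingCoercivity
import Literature.Geometry.Lorentzian.KerrEnergyIdentity
import Literature.Geometry.Lorentzian.MultiCentreKerrSchild

/-!
# Route EIHFluxBalance — `InertialRecession`, line `sublinear-is-free-clean-window-charges`:
# late-time coercivity of the frozen ansatz near a hole, and the lab components as metric components
# (slaving stub `stub_slaving`)

Helper file for the crux `stmt-FinalStateConjecture-10166`
(`Summit.FinalStateConjecture.FinalStateConjecture.Theses.EIHFluxBalance.InertialRecession`),
stub `stub_slaving`. Quantitative inputs of the capstone `exists_abs_ricAt_ansatz_le_jet`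
(companion file `…StubSlaving3RicciNearHole`):

* `eventually_coercive_near_hole` — at late lab times, on every hole-following region
  `{x⁰ = t, ‖x̲ − ξᵢ(t)‖ ≤ R, rᵢ ≥ r₀ > 0}`: all painted radii are positive, the ansatz
  `g₀ = η + Σⱼ (boostedKerrBilin (Λⱼ(x⁰)) (x⁰, ξⱼ(x⁰)) Mⱼ aⱼ − η)` is `m/2`-coercive
  (`m = ((1 + 3γ)²(1 + 4|Mᵢ|/r₀))⁻¹`) and the `C⁰` deviation is `< m/4` (the quantitative content of
  `eventually_injective_mfderiv_near_hole`, `…StubSlavingImmersion`);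
* `norm_sharpAt_le_of_coercive` — `‖♯(G)(x)‖ ≤ c⁻¹` for a `c`-coercive invertible form;
* `isMetricOn_labMetric` — the lab components `(Φ^*g − g₀) + g₀` are metric components
  (`MetricCoord.IsMetricOn`) on every open set where `dΦ` is injective (the pull-back metric
  `PseudoRiemannianMetric.comap` along the immersion `Φ`, `OpensChart.isMetricOn_repr`);
* `norm_fderiv_eq_norm_iteratedFDeriv` — `‖Df‖ = ‖D¹f‖`, `‖D(Df)‖ = ‖D²f‖`.

(Two elementary estimates of `…StubSlavingImmersion` — the `C⁰` size of a summand and far ⇒ large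
painted radius — are re-derived inline, because that module's compiled interface was unavailable on the
build farm when this file was prepared.)
-/

set_option linter.dupNamespace false
set_option maxSynthPendingDepth 3

noncomputable section

open scoped Topology Manifold ContDiff
open Filter Set Function TopologicalSpace Literature.Geometry.Lorentzian
  Summit.FinalStateConjecture.FinalStateConjecture.Theorems

namespace Summit.FinalStateConjecture.FinalStateConjecture.Theorems.SublinearIsFree.Slaving

/-! ### Quantitative coercivity of the ansatz near a hole at late times -/

section Coercive

variable (𝓢 : Spacetime 4)

/-- **Late-time coercivity of the modulated ansatz near a hole, quantitatively.** With
`m = ((1 + 3γ)²(1 + 4|Mᵢ|/r₀))⁻¹`: eventually in the lab time `t`, at every chart point `x` of the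
slab `{x⁰ = t}` with `‖x̲ − ξᵢ(t)‖ ≤ R` and `rᵢ(x) ≥ r₀`, (1) every painted radius `rⱼ(x)` is
positive, (2) the ansatz is `m/2`-coercive, `(m/2)‖v‖ ≤ ‖g₀(x)(v, ·)‖`, and (3) the `C⁰`
deviation satisfies `‖(Φ^*g − g₀)(x)‖ < m/4`. (Hole `i` is `m`-coercive by
`norm_le_const_mul_norm_boostedKerrBilin`; the other summands are `≤ m/(2N)` each since their
centres recede, `norm_boostedKerrBilin_sub_minkowski_le`; the deviation tends to `0`.) [folklore] -/
theorem eventually_coercive_near_hole {N : ℕ} {M a : Fin N → ℝ}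
    {Λ : Fin N → ℝ → lorentzGroup} {ξ : Fin N → ℝ → E3} {γ : ℝ} {U : Opens E4}
    (hγ : ∀ i t, |((Λ i t : E4 ≃L[ℝ] E4) (E4.basisVector 0)) 0| ≤ γ)
    (hsep : ∀ i j, i ≠ j → Tendsto (fun t ↦ ‖ξ i t - ξ j t‖) atTop atTop)
    {Φ : U → 𝓢.carrier}
    (hdev : Tendsto (fun t ↦ 𝓢.deviationCk ⟨U, fun x ↦ Minkowski.bilin +
      ∑ i, (boostedKerrBilin (Λ i (x 0)) (E4.ofTimeSpace (x 0) (ξ i (x 0))) (M i) (a i) x -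
        Minkowski.bilin), fun x ↦ x 0, E4.spatialNorm⟩ Φ 0 t) atTop (𝓝 0))
    (i : Fin N) (R : ℝ) {r₀ : ℝ} (hr₀ : 0 < r₀) :
    ∀ᶠ t in atTop, ∀ x : U, x.1 0 = t → ‖E4.spatial x.1 - ξ i t‖ ≤ R →
      r₀ ≤ Kerr.radius (a i) (poincareInv (Λ i t) (E4.ofTimeSpace t (ξ i t)) x.1) →
      (∀ j, 0 < Kerr.radius (a j) (poincareInv (Λ j t) (E4.ofTimeSpace t (ξ j t)) x.1)) ∧
      (∀ v : E4, ((1 + 3 * γ) ^ 2 * (1 + 4 * (|M i| / r₀)))⁻¹ / 2 * ‖v‖ ≤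
        ‖(Minkowski.bilin + ∑ j, (boostedKerrBilin (Λ j (x.1 0)) (E4.ofTimeSpace (x.1 0)
          (ξ j (x.1 0))) (M j) (a j) x.1 - Minkowski.bilin)) v‖) ∧
      ‖𝓢.deviation ⟨U, fun x ↦ Minkowski.bilin +
        ∑ i, (boostedKerrBilin (Λ i (x 0)) (E4.ofTimeSpace (x 0) (ξ i (x 0))) (M i) (a i) x -
          Minkowski.bilin), fun x ↦ x 0, E4.spatialNorm⟩ Φ x‖ <
        ((1 + 3 * γ) ^ 2 * (1 + 4 * (|M i| / r₀)))⁻¹ / 4 := by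
  set B : ModelBackground := ⟨U, fun x ↦ Minkowski.bilin +
      ∑ i, (boostedKerrBilin (Λ i (x 0)) (E4.ofTimeSpace (x 0) (ξ i (x 0))) (M i) (a i) x -
        Minkowski.bilin), fun x ↦ x 0, E4.spatialNorm⟩ with hB
  have hN : (0 : ℝ) < N := by exact_mod_cast Fin.pos i
  have hγ1 : 1 ≤ γ := (one_le_abs_lorentz_apply_zero (Λ i 0)).trans (hγ i 0)
  set K : ℝ := (1 + 3 * γ) ^ 2 * (1 + 4 * (|M i| / r₀)) with hK
  have hK1 : 1 ≤ K := by
    have h1 : (1 : ℝ) ≤ (1 + 3 * γ) ^ 2 := by nlinarith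
    have h2 : (1 : ℝ) ≤ 1 + 4 * (|M i| / r₀) := by
      have : 0 ≤ |M i| / r₀ := by positivity
      linarith
    nlinarith
  have hK0 : 0 < K := by linarith
  set m : ℝ := K⁻¹ with hm
  have hm0 : 0 < m := inv_pos.mpr hK0
  set L : ℝ := 8 * N * (1 + 3 * γ) ^ 2 * (∑ j, |M j| + 1) / m with hL
  have hL0 : 0 < L := by positivity
  have E1 : ∀ j, ∀ᶠ t in atTop, j ≠ i → R + (|a j| + L) ≤ ‖ξ i t - ξ j t‖ := by
    intro j
    by_cases hij : j = i
    · exact Eventually.of_forall fun t h ↦ (h hij).elim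
    · exact ((hsep i j (Ne.symm hij)).eventually_ge_atTop _).mono fun t ht _ ↦ ht
  have E2 : ∀ᶠ t in atTop, 𝓢.deviationCk B Φ 0 t < ENNReal.ofReal (m / 4) :=
    (tendsto_order.1 hdev).2 _ (ENNReal.ofReal_pos.2 (by positivity))
  filter_upwards [eventually_all.2 E1, E2] with t ht1 ht2 x hx0 hxR hxr
  -- radii of the other holes
  have hradius : ∀ j, j ≠ i →
      L ≤ Kerr.radius (a j) (poincareInv (Λ j t) (E4.ofTimeSpace t (ξ j t)) x.1) := by
    intro j hij
    have hfar : |a j| + L ≤ ‖E4.spatial x.1 - ξ j t‖ := by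
      have htri : ‖ξ i t - ξ j t‖ ≤ ‖E4.spatial x.1 - ξ i t‖ + ‖E4.spatial x.1 - ξ j t‖ := by
        calc ‖ξ i t - ξ j t‖ = ‖(E4.spatial x.1 - ξ j t) - (E4.spatial x.1 - ξ i t)‖ := by
              congr 1; abel
          _ ≤ ‖E4.spatial x.1 - ξ j t‖ + ‖E4.spatial x.1 - ξ i t‖ := norm_sub_le _ _
          _ = _ := add_comm _ _
      linarith [ht1 j hij]
    -- far in the lab ⇒ large painted radius (`sq_sub_sq_le_radius_poincareInv_sq`)
    have h1 := sq_sub_sq_le_radius_poincareInv_sq (Λ j t) (a j) t (ξ j t) hx0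
    have h2 : L ^ 2 ≤ Kerr.radius (a j) (poincareInv (Λ j t) (E4.ofTimeSpace t (ξ j t)) x.1) ^ 2 := by
      have h3 : (|a j| + L) ^ 2 ≤ ‖E4.spatial x.1 - ξ j t‖ ^ 2 :=
        pow_le_pow_left₀ (by positivity) hfar 2
      nlinarith [sq_abs (a j), abs_nonneg (a j)]
    exact (pow_le_pow_iff_left₀ hL0.le (Kerr.radius_nonneg _ _) two_ne_zero).mp h2
  have hrpos : ∀ j, 0 < Kerr.radius (a j) (poincareInv (Λ j t) (E4.ofTimeSpace t (ξ j t)) x.1) := by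
    intro j
    by_cases hij : j = i
    · subst hij; exact hr₀.trans_le hxr
    · exact hL0.trans_le (hradius j hij)
  -- (1) hole `i` is `m`-coercive at `x`
  have hcoer : ∀ v : E4, m * ‖v‖ ≤
      ‖boostedKerrBilin (Λ i t) (E4.ofTimeSpace t (ξ i t)) (M i) (a i) x.1 v‖ := by
    intro v
    rw [hm, inv_mul_le_iff₀ hK0]
    exact norm_le_const_mul_norm_boostedKerrBilin (Λ i t) _ (M i) (a i) (hγ i t) hr₀ hxr v
  -- (2) the other summands are small at `x`
  have hcross : ∀ j, j ≠ i →
      ‖boostedKerrBilin (Λ j t) (E4.ofTimeSpace t (ξ j t)) (M j) (a j) x.1 - Minkowski.bilin‖ ≤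
        m / (2 * N) := by
    intro j hij
    have hrL := hradius j hij
    have hrp := hrpos j
    -- `C⁰` size of the summand: `‖bK − η‖ ≤ 4|H(y)|‖Λ⁻¹‖²` (`|ℓ(w)| ≤ √2‖w‖`)
    have h1 : ‖boostedKerrBilin (Λ j t) (E4.ofTimeSpace t (ξ j t)) (M j) (a j) x.1 - Minkowski.bilin‖ ≤
        4 * |Kerr.scalarH (M j) (a j) (poincareInv (Λ j t) (E4.ofTimeSpace t (ξ j t)) x.1)| *
          ‖(((Λ j t : E4 ≃L[ℝ] E4).symm : E4 →L[ℝ] E4))‖ ^ 2 := by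
      set Lj : lorentzGroup := Λ j t with hLj
      set cj : E4 := E4.ofTimeSpace t (ξ j t) with hcj
      set Li : E4 →L[ℝ] E4 := ((Lj : E4 ≃L[ℝ] E4).symm : E4 →L[ℝ] E4) with hLi
      set y := poincareInv Lj cj x.1 with hy
      have hy0 : 0 < Kerr.radius (a j) y := hrp
      refine ContinuousLinearMap.opNorm_le_bound _ (by positivity) fun v ↦ ?_
      refine ContinuousLinearMap.opNorm_le_bound _ (by positivity) fun w ↦ ?_
      rw [boostedKerrBilin_sub_minkowski_apply, ← hy, sub_apply, sub_apply, Kerr.bilin_apply,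
        add_sub_cancel_left, Real.norm_eq_abs, abs_mul, abs_mul, abs_mul, abs_two]
      have hv : |Kerr.nullCovector (a j) y ((Lj : E4 ≃L[ℝ] E4).symm v)| ≤ √2 * (‖Li‖ * ‖v‖) :=
        (abs_nullCovector_apply_le hy0 _).trans (by gcongr; exact Li.le_opNorm v)
      have hw : |Kerr.nullCovector (a j) y ((Lj : E4 ≃L[ℝ] E4).symm w)| ≤ √2 * (‖Li‖ * ‖w‖) :=
        (abs_nullCovector_apply_le hy0 _).trans (by gcongr; exact Li.le_opNorm w)
      have hs : √2 * √2 = 2 := Real.mul_self_sqrt (by norm_num)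
      calc 2 * |Kerr.scalarH (M j) (a j) y| * (|Kerr.nullCovector (a j) y ((Lj : E4 ≃L[ℝ] E4).symm v)| *
            |Kerr.nullCovector (a j) y ((Lj : E4 ≃L[ℝ] E4).symm w)|)
          ≤ 2 * |Kerr.scalarH (M j) (a j) y| * ((√2 * (‖Li‖ * ‖v‖)) * (√2 * (‖Li‖ * ‖w‖))) := by
            gcongr
        _ = 4 * |Kerr.scalarH (M j) (a j) y| * ‖Li‖ ^ 2 * ‖v‖ * ‖w‖ := by
            linear_combination (2 * |Kerr.scalarH (M j) (a j) y| * ‖Li‖ ^ 2 * ‖v‖ * ‖w‖) * hs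
    have hH : |Kerr.scalarH (M j) (a j) (poincareInv (Λ j t) (E4.ofTimeSpace t (ξ j t)) x.1)| ≤
        |M j| / L :=
      (abs_scalarH_le (M j) (a j) hrp).trans (div_le_div_of_nonneg_left (abs_nonneg _) hL0 hrL)
    have hLi : ‖(((Λ j t : E4 ≃L[ℝ] E4).symm : E4 →L[ℝ] E4))‖ ^ 2 ≤ (1 + 3 * γ) ^ 2 :=
      pow_le_pow_left₀ (norm_nonneg _) ((norm_lorentz_symm_le' (Λ j t)).trans (by
        linarith [hγ j t])) 2
    have hMj : |M j| ≤ ∑ k, |M k| + 1 :=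
      (Finset.single_le_sum (fun k _ ↦ abs_nonneg (M k)) (Finset.mem_univ j)).trans (by linarith)
    calc ‖boostedKerrBilin (Λ j t) (E4.ofTimeSpace t (ξ j t)) (M j) (a j) x.1 - Minkowski.bilin‖
        ≤ 4 * (|M j| / L) * (1 + 3 * γ) ^ 2 := h1.trans (by gcongr)
      _ ≤ 4 * ((∑ k, |M k| + 1) / L) * (1 + 3 * γ) ^ 2 := by gcongr
      _ = m / (2 * N) := by
          rw [hL]
          field_simp
          ring
  -- (3) hence the full reference field is `m/2`-coercive at `x`
  have hsum : B.bilin x.1 = boostedKerrBilin (Λ i t) (E4.ofTimeSpace t (ξ i t)) (M i) (a i) x.1 +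
      ∑ j ∈ Finset.univ.erase i, (boostedKerrBilin (Λ j t) (E4.ofTimeSpace t (ξ j t)) (M j) (a j)
        x.1 - Minkowski.bilin) := by
    show Minkowski.bilin + ∑ j, (boostedKerrBilin (Λ j (x.1 0)) (E4.ofTimeSpace (x.1 0)
      (ξ j (x.1 0))) (M j) (a j) x.1 - Minkowski.bilin) = _
    rw [hx0, ← Finset.add_sum_erase _ _ (Finset.mem_univ i)]
    abel
  have hE : ‖∑ j ∈ Finset.univ.erase i, (boostedKerrBilin (Λ j t) (E4.ofTimeSpace t (ξ j t)) (M j)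
      (a j) x.1 - Minkowski.bilin)‖ ≤ m / 2 := by
    refine (norm_sum_le (Finset.univ.erase i) fun j ↦ boostedKerrBilin (Λ j t)
      (E4.ofTimeSpace t (ξ j t)) (M j) (a j) x.1 - Minkowski.bilin).trans ?_
    calc ∑ j ∈ Finset.univ.erase i, ‖boostedKerrBilin (Λ j t) (E4.ofTimeSpace t (ξ j t)) (M j)
          (a j) x.1 - Minkowski.bilin‖
        ≤ ∑ j ∈ Finset.univ.erase i, m / (2 * N) :=
          Finset.sum_le_sum fun j hj ↦ hcross j (Finset.ne_of_mem_erase hj)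
      _ ≤ ∑ _j : Fin N, m / (2 * N) :=
          Finset.sum_le_sum_of_subset_of_nonneg (Finset.erase_subset _ _)
            fun _ _ _ ↦ by positivity
      _ = m / 2 := by
          rw [Finset.sum_const, Finset.card_univ, Fintype.card_fin, nsmul_eq_mul]
          field_simp
  have hm' : ∀ v : E4, m / 2 * ‖v‖ ≤ ‖B.bilin x.1 v‖ := by
    intro v
    rw [hsum, show m / 2 = m - m / 2 by ring]
    exact coercive_add_of_norm_le hcoer hE v
  -- (4) and the deviation at `x` is `< m/4`
  have hmem : x.1 ∈ Subtype.val '' B.timeSlab t := ⟨x, hx0, rfl⟩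
  have hdx : ‖𝓢.deviation B Φ x‖ < m / 4 := by
    have h1 := enorm_iteratedFDeriv_le_supCkENorm (le_refl 0) hmem (𝓢.deviationExtend B Φ)
    rw [← ofReal_norm, norm_iteratedFDeriv_zero, 𝓢.deviationExtend_coe] at h1
    have h2 : ENNReal.ofReal ‖𝓢.deviation B Φ x‖ < ENNReal.ofReal (m / 4) := h1.trans_lt ht2
    rwa [ENNReal.ofReal_lt_ofReal_iff (by positivity)] at h2
  refine ⟨hrpos, fun v ↦ ?_, hdx⟩
  have := hm' v
  rwa [hB] at this

end Coercive

/-! ### `♯` bounds and metric components -/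

/-- **`‖♯‖ ≤ c⁻¹` for a `c`-coercive invertible form**: if `c ‖v‖ ≤ ‖A(v, ·)‖` for all `v` and
`A` is invertible then `‖A⁻¹‖ ≤ c⁻¹`. [folklore] -/
theorem norm_sharpAt_le_of_coercive {G : E4 → E4 →L[ℝ] E4 →L[ℝ] ℝ} {x : E4} {c : ℝ} (hc : 0 < c)
    (hcoer : ∀ v : E4, c * ‖v‖ ≤ ‖G x v‖) (hinv : (G x).IsInvertible) :
    ‖MetricCoord.sharpAt G x‖ ≤ c⁻¹ := by
  obtain ⟨e, he⟩ := hinv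
  have hsharp : MetricCoord.sharpAt G x = ((e.symm : (E4 →L[ℝ] ℝ) ≃L[ℝ] E4) : (E4 →L[ℝ] ℝ) →L[ℝ] E4) := by
    rw [MetricCoord.sharpAt, ← he, ContinuousLinearMap.inverse_equiv]
  rw [hsharp]
  refine ContinuousLinearMap.opNorm_le_bound _ (inv_nonneg.2 hc.le) fun α ↦ ?_
  have h1 := hcoer (e.symm α)
  have h2 : G x (e.symm α) = α := by
    rw [← he]; exact e.apply_symm_apply α
  rw [h2] at h1
  rw [le_inv_mul_iff₀ hc]
  exact h1

/-- **The lab components are metric components where the chart map is an immersion.** For a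
smooth chart map `Φ : U → 𝓢` of a `4`-dimensional spacetime and an open `A ≤ U` on which `dΦ` is
injective, the lab components `z ↦ (Φ^*g − g₀)(z) + g₀(z)` are `C^∞`, symmetric and invertible on
`A` (`MetricCoord.IsMetricOn`): they represent the pull-back pseudo-Riemannian metric
`PseudoRiemannianMetric.comap` on the open submanifold `A` (O'Neill 1983, Ch. 3, Def. 3.1;
`OpensChart.isMetricOn_repr`). [folklore] -/
theorem isMetricOn_labMetric (𝓢 : Spacetime 4) (B : ModelBackground) {Φ : B.domain → 𝓢.carrier}
    (hΦ : ContMDiff 𝓘(ℝ, E4) (𝓡 4) ∞ Φ) {A : Opens E4} (hA : A ≤ B.domain)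
    (hinj : ∀ y : A, Function.Injective (mfderiv 𝓘(ℝ, E4) (𝓡 4) Φ (Opens.inclusion hA y))) :
    MetricCoord.IsMetricOn (fun z ↦ 𝓢.deviationExtend B Φ z + B.bilin z) (A : Set E4) := by
  have hΦd : MDifferentiable 𝓘(ℝ, E4) (𝓡 4) Φ := hΦ.mdifferentiable (by simp)
  have hid : MDifferentiable 𝓘(ℝ, E4) 𝓘(ℝ, E4) (Opens.inclusion hA) :=
    (contMDiff_inclusion (n := ∞) hA).mdifferentiable (by simp)
  have hΦ' : ContMDiff 𝓘(ℝ, E4) (𝓡 4) (∞ + 1) (Φ ∘ Opens.inclusion hA) := by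
    have h : ((∞ : ℕ∞ω) + 1) = ∞ := rfl
    rw [h]
    exact hΦ.comp (contMDiff_inclusion hA)
  have hmf : ∀ (z : A) (u : E4), mfderiv 𝓘(ℝ, E4) (𝓡 4) (Φ ∘ Opens.inclusion hA) z u =
      mfderiv 𝓘(ℝ, E4) (𝓡 4) Φ (Opens.inclusion hA z) u := by
    intro z u
    have hc := mfderiv_comp z (hΦd (Opens.inclusion hA z)) (hid z)
    rw [hc]
    exact congrArg (mfderiv 𝓘(ℝ, E4) (𝓡 4) Φ (Opens.inclusion hA z))
      (OpensChart.mfderiv_inclusion_apply hA z u)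
  have hinj' : ∀ z : A,
      Function.Injective (mfderiv 𝓘(ℝ, E4) (𝓡 4) (Φ ∘ Opens.inclusion hA) z) := by
    intro z u u' h
    rw [hmf, hmf] at h
    exact hinj z h
  have hdim : Module.finrank ℝ E4 = Module.finrank ℝ (EuclideanSpace ℝ (Fin 4)) := rfl
  set g' := 𝓢.metric.toPseudoRiemannianMetric.comap
    PseudoRiemannianMetric.contMDiff_pullbackBilin_holds (Φ ∘ Opens.inclusion hA) hΦ' hinj' hdim
    with hg'
  have hrepr : ∀ z : A, g'.val z = (fun z ↦ 𝓢.deviationExtend B Φ z + B.bilin z) z.1 := by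
    intro z
    have e2 : 𝓢.deviationExtend B Φ z.1 = 𝓢.deviation B Φ (Opens.inclusion hA z) :=
      𝓢.deviationExtend_coe B Φ (Opens.inclusion hA z)
    rw [hg', PseudoRiemannianMetric.val_comap]
    ext u u'
    rw [pullbackBilin_apply, hmf, hmf]
    change _ = (𝓢.deviationExtend B Φ z.1 + B.bilin z.1) u u'
    rw [add_apply, add_apply, e2, 𝓢.deviation_apply,
      sub_add_cancel]
    rfl
  exact OpensChart.isMetricOn_repr hrepr

/-- `fderiv` of metric components: `‖Df(x)‖ = ‖D¹f(x)‖` and `‖D(Df)(x)‖ = ‖D²f(x)‖` (Mathlib's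
`norm_iteratedFDeriv_fderiv`, restated for the two orders used). [folklore] -/
theorem norm_fderiv_eq_norm_iteratedFDeriv {F : Type*} [NormedAddCommGroup F] [NormedSpace ℝ F]
    (f : E4 → F) (x : E4) :
    ‖fderiv ℝ f x‖ = ‖iteratedFDeriv ℝ 1 f x‖ ∧
      ‖fderiv ℝ (fderiv ℝ f) x‖ = ‖iteratedFDeriv ℝ 2 f x‖ := by
  constructor
  · rw [← norm_iteratedFDeriv_fderiv (n := 0), norm_iteratedFDeriv_zero]
  · rw [← norm_iteratedFDeriv_fderiv (n := 1), ← norm_iteratedFDeriv_fderiv (n := 0),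
      norm_iteratedFDeriv_zero]

/-- **Registered sub-goal form** (worker carrier `slaving_eventually_coercive_near_hole` of the crux
item) of `eventually_coercive_near_hole`: late-time coercivity of the frozen ansatz near a hole,
positivity of all painted radii there, and `C⁰`-smallness of the deviation. [folklore] -/
theorem slaving_eventually_coercive_near_hole : open Literature.Geometry.Lorentzian Filter Topology in ∀ (𝓢 : Spacetime 4) {N : ℕ} {M a : Fin N → ℝ} {Λ : Fin N → ℝ → lorentzGroup} {ξ : Fin N → ℝ → E3} {γ : ℝ} {U : Opens E4}, (∀ i t, |((Λ i t : E4 ≃L[ℝ] E4) (E4.basisVector 0)) 0| ≤ γ) → (∀ i j, i ≠ j → Tendsto (fun t ↦ ‖ξ i t - ξ j t‖) atTop atTop) → ∀ {Φ : U → 𝓢.carrier}, Tendsto (fun t ↦ 𝓢.deviationCk ⟨U, fun x ↦ Minkowski.bilin + ∑ i, (boostedKerrBilin (Λ i (x 0)) (E4.ofTimeSpace (x 0) (ξ i (x 0))) (M i) (a i) x - Minkowski.bilin), fun x ↦ x 0, E4.spatialNorm⟩ Φ 0 t) atTop (𝓝 0) → ∀ (i : Fin N) (R : ℝ) {r₀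 : ℝ}, 0 < r₀ → ∀ᶠ t in atTop, ∀ x : U, x.1 0 = t → ‖E4.spatial x.1 - ξ i t‖ ≤ R → r₀ ≤ Kerr.radius (a i) (poincareInv (Λ i t) (E4.ofTimeSpace t (ξ i t)) x.1) → (∀ j, 0 < Kerr.radius (a j) (poincareInv (Λ j t) (E4.ofTimeSpace t (ξ j t)) x.1)) ∧ (∀ v : E4, ((1 + 3 * γ) ^ 2 * (1 + 4 * (|M i| / r₀)))⁻¹ / 2 * ‖v‖ ≤ ‖(Minkowski.bilin + ∑ j, (boostedKerrBilin (Λ j (x.1 0)) (E4.ofTimeSpace (x.1 0) (ξ j (x.1 0))) (M j) (a j) x.1 - Minkowski.bilin)) v‖) ∧ ‖𝓢.deviation ⟨U, fun x ↦ Minkowski.bilin + ∑ i, (boostedKerrBilin (Λ i (x 0)) (E4.ofTimeSpace (x 0) (ξ i (x 0))) (M i) (a i) x - Minkowski.bilin), fun x ↦ x 0, E4.spatialNorm⟩ Φ x‖ < ((1 + 3 * γ) ^ 2 * (1 + 4 * (|M i| / r₀)))⁻¹ / 4 :=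
  fun 𝓢 _ _ _ _ _ _ _ hγ hsep _ hdev i R _ hr₀ ↦ eventually_coercive_near_hole 𝓢 hγ hsep hdev i R hr₀

end Summit.FinalStateConjecture.FinalStateConjecture.Theorems.SublinearIsFree.Slaving

end
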